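import Summits.Parity.GeneralizedHardyLittlewood.Theorems.GreenTaoLevelTwoMNTwoCauchySchwarz

/-!
# Route `GreenTaoLevelTwo`, crux `MNTwo` (stmt-Parity-21276), line `birth`, stub `stub_mnVertical`:
# the four-variable box Cauchy–Schwarz inequality (GT 2008b App. A Lemma 38, third form)

Tool for block V4 / H3 (= AIF §10 Lemma 24 "Type II sum implies major arc", the step "Applying
Lemma (cz) to eliminate the `b()` factors") of the `stub_mnVertical` census (B. Green, T. Tao,
*Quadratic uniformity of the Möbius function*, Ann. Inst. Fourier 58 (2008) = arXiv:math/0606087,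
App. A Lemma 38, third claim: for `K : X⁴ → ℂ` and `1`-bounded `b`'s each independent of one
variable, `|𝔼 b(x₂,x₃,x₄)b(x₁,x₃,x₄)b(x₁,x₂,x₄)b(x₁,x₂,x₃)K(x₁,…,x₄)| ≪ |𝔼 ∏_{i∈{0,1}⁴} C^{|i|} K(x_{1,i₁},…,x_{4,i₄})|^{1/16}`,
"four iterations of the first claim").  Def-free, plain finite sums over four arbitrary index
types, exact constant: `‖Σ‖¹⁶ ≤ (#X₁#X₂#X₃#X₄)¹⁴ · Re Σ₈ ∏₁₆`.

* `gen_step`, `gen_step₀` — one doubling step with (resp. without) parameters: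
  `(∑_p ‖∑_y ∑_x b(p,y) f(p,x,y)‖)² ≤ #P·#Y·∑_p ∑_{x,x'} ‖∑_y f(p,x,y) conj f(p,x',y)‖`;
* `final_step` — the last doubling, keeping the real part:
  `(∑_p ‖∑_x b(p) f(p,x)‖)² ≤ #P · Re ∑_p ∑_{x,x'} f(p,x) conj f(p,x')`;
* `chain_ineq` — exponent bookkeeping;
* `box_norm_pow_sixteen_le` — **Lemma 38, third form**.

References: [GreenTao2008QuadraticMobius] arXiv:math/0606087 App. A Lemma 38; §10 (Lemma 24).
-/

open Finset
open scoped ComplexConjugate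

namespace Summit.Parity.GeneralizedHardyLittlewood.GreenTaoLevelTwoMNTwoBoxCauchySchwarz

open Summit.Parity.GeneralizedHardyLittlewood.GreenTaoLevelTwoMNTwoCauchySchwarz
  (norm_sq_sum_eq_re_sum_sum sq_sum_le_card_mul_sum_sq' norm_sq_sum_sum_le)

variable {α X Y : Type*}

/-- **One doubling step** (Lemma 38, first form, with parameters and absolute values outside):
for `‖b(p,y)‖ ≤ 1`,
`(∑_p ‖∑_y ∑_x b(p,y) f(p,x,y)‖)² ≤ #P · #Y · ∑_p ∑_x ∑_{x'} ‖∑_y f(p,x,y) conj f(p,x',y)‖`.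
[cite: GreenTao2008QuadraticMobius, App. A Lemma 38 (proof: "iterations of the first claim")] -/
theorem gen_step (P : Finset α) (t : Finset Y) (s : Finset X) (b : α → Y → ℂ)
    (hb : ∀ p y, ‖b p y‖ ≤ 1) (f : α → X → Y → ℂ) :
    (∑ p ∈ P, ‖∑ y ∈ t, ∑ x ∈ s, b p y * f p x y‖) ^ 2 ≤
      #P * #t * ∑ p ∈ P, ∑ x ∈ s, ∑ x' ∈ s, ‖∑ y ∈ t, f p x y * conj (f p x' y)‖ := by
  -- for each `p`: `‖∑_y ∑_x b f‖² ≤ #Y ∑_y ‖∑_x f‖² = #Y Re ∑_{x,x'} ∑_y f conj f ≤ #Y ∑_{x,x'} ‖∑_y …‖`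
  have hp : ∀ p ∈ P, ‖∑ y ∈ t, ∑ x ∈ s, b p y * f p x y‖ ^ 2 ≤
      #t * ∑ x ∈ s, ∑ x' ∈ s, ‖∑ y ∈ t, f p x y * conj (f p x' y)‖ := by
    intro p _
    have h1 := norm_sq_sum_sum_le t s (b p) (fun y _ => hb p y) (fun y x => f p x y)
    have h2 : ∑ y ∈ t, ‖∑ x ∈ s, f p x y‖ ^ 2 =
        (∑ x ∈ s, ∑ x' ∈ s, ∑ y ∈ t, f p x y * conj (f p x' y)).re := by
      rw [Finset.sum_congr rfl fun y _ => norm_sq_sum_eq_re_sum_sum s (fun x => f p x y),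
        ← Complex.re_sum]
      congr 1
      calc ∑ y ∈ t, ∑ x ∈ s, ∑ x' ∈ s, f p x y * conj (f p x' y)
          = ∑ x ∈ s, ∑ y ∈ t, ∑ x' ∈ s, f p x y * conj (f p x' y) := Finset.sum_comm
        _ = ∑ x ∈ s, ∑ x' ∈ s, ∑ y ∈ t, f p x y * conj (f p x' y) :=
            Finset.sum_congr rfl fun x _ => Finset.sum_comm
    have h3 : (∑ x ∈ s, ∑ x' ∈ s, ∑ y ∈ t, f p x y * conj (f p x' y)).re ≤
        ∑ x ∈ s, ∑ x' ∈ s, ‖∑ y ∈ t, f p x y * conj (f p x' y)‖ := by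
      rw [Complex.re_sum]
      refine Finset.sum_le_sum fun x _ => ?_
      rw [Complex.re_sum]
      exact Finset.sum_le_sum fun x' _ => Complex.re_le_norm _
    calc ‖∑ y ∈ t, ∑ x ∈ s, b p y * f p x y‖ ^ 2 ≤ #t * ∑ y ∈ t, ‖∑ x ∈ s, f p x y‖ ^ 2 := h1
      _ ≤ #t * ∑ x ∈ s, ∑ x' ∈ s, ‖∑ y ∈ t, f p x y * conj (f p x' y)‖ := by
          rw [h2]; exact mul_le_mul_of_nonneg_left h3 (by positivity)
  calc (∑ p ∈ P, ‖∑ y ∈ t, ∑ x ∈ s, b p y * f p x y‖) ^ 2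
      ≤ #P * ∑ p ∈ P, ‖∑ y ∈ t, ∑ x ∈ s, b p y * f p x y‖ ^ 2 := sq_sum_le_card_mul_sum_sq' P _
    _ ≤ #P * ∑ p ∈ P, (#t * ∑ x ∈ s, ∑ x' ∈ s, ‖∑ y ∈ t, f p x y * conj (f p x' y)‖) :=
        mul_le_mul_of_nonneg_left (Finset.sum_le_sum hp) (by positivity)
    _ = _ := by rw [← Finset.mul_sum]; ring

/-- **The last doubling step** (real part kept): for `‖b(p)‖ ≤ 1`,
`(∑_p ‖∑_x b(p) f(p,x)‖)² ≤ #P · Re ∑_p ∑_x ∑_{x'} f(p,x) conj f(p,x')`.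
[cite: GreenTao2008QuadraticMobius, App. A Lemma 38 (proof)] -/
theorem final_step (P : Finset α) (s : Finset X) (b : α → ℂ) (hb : ∀ p, ‖b p‖ ≤ 1)
    (f : α → X → ℂ) :
    (∑ p ∈ P, ‖∑ x ∈ s, b p * f p x‖) ^ 2 ≤
      #P * (∑ p ∈ P, ∑ x ∈ s, ∑ x' ∈ s, f p x * conj (f p x')).re := by
  have hp : ∀ p ∈ P, ‖∑ x ∈ s, b p * f p x‖ ≤ ‖∑ x ∈ s, f p x‖ := by
    intro p _
    rw [← Finset.mul_sum, norm_mul]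
    calc ‖b p‖ * ‖∑ x ∈ s, f p x‖ ≤ 1 * ‖∑ x ∈ s, f p x‖ :=
          mul_le_mul_of_nonneg_right (hb p) (norm_nonneg _)
      _ = _ := one_mul _
  calc (∑ p ∈ P, ‖∑ x ∈ s, b p * f p x‖) ^ 2 ≤ (∑ p ∈ P, ‖∑ x ∈ s, f p x‖) ^ 2 :=
        pow_le_pow_left₀ (Finset.sum_nonneg fun _ _ => norm_nonneg _) (Finset.sum_le_sum hp) 2
    _ ≤ #P * ∑ p ∈ P, ‖∑ x ∈ s, f p x‖ ^ 2 := sq_sum_le_card_mul_sum_sq' P _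
    _ = #P * (∑ p ∈ P, ∑ x ∈ s, ∑ x' ∈ s, f p x * conj (f p x')).re := by
        rw [Complex.re_sum]
        exact congrArg _ (Finset.sum_congr rfl fun p _ => norm_sq_sum_eq_re_sum_sum s (f p))

/-- **One doubling step without parameters**: for `‖b(y)‖ ≤ 1`,
`‖∑_y ∑_x b(y) f(x,y)‖² ≤ #Y · ∑_x ∑_{x'} ‖∑_y f(x,y) conj f(x',y)‖`.
[cite: GreenTao2008QuadraticMobius, App. A Lemma 38 (proof)] -/
theorem gen_step₀ (t : Finset Y) (s : Finset X) (b : Y → ℂ) (hb : ∀ y, ‖b y‖ ≤ 1)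
    (f : X → Y → ℂ) :
    ‖∑ y ∈ t, ∑ x ∈ s, b y * f x y‖ ^ 2 ≤
      #t * ∑ x ∈ s, ∑ x' ∈ s, ‖∑ y ∈ t, f x y * conj (f x' y)‖ := by
  have h := gen_step (Finset.univ : Finset Unit) t s (fun _ y => b y) (fun _ y => hb y)
    (fun _ x y => f x y)
  rw [Fintype.sum_unique, Fintype.sum_unique, Finset.card_univ, Fintype.card_unit, Nat.cast_one,
    one_mul] at h
  exact h

/-- The exponent bookkeeping of the four doubling steps. [folklore] -/
theorem chain_ineq {S A₁ A₂ A₃ R N₁ N₂ N₃ N₄ : ℝ}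
    (h1 : S ^ 2 ≤ N₂ * N₃ * N₄ * A₁) (h2 : A₁ ^ 2 ≤ N₁ ^ 2 * (N₃ * N₄) * A₂)
    (h3 : A₂ ^ 2 ≤ N₁ ^ 2 * N₂ ^ 2 * N₄ * A₃) (h4 : A₃ ^ 2 ≤ N₁ ^ 2 * N₂ ^ 2 * N₃ ^ 2 * R) :
    S ^ 16 ≤ (N₁ * N₂ * N₃ * N₄) ^ 14 * R := by
  calc S ^ 16 = (S ^ 2) ^ 8 := by ring
    _ ≤ (N₂ * N₃ * N₄ * A₁) ^ 8 := pow_le_pow_left₀ (by positivity) h1 8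
    _ = (N₂ * N₃ * N₄) ^ 8 * (A₁ ^ 2) ^ 4 := by ring
    _ ≤ (N₂ * N₃ * N₄) ^ 8 * (N₁ ^ 2 * (N₃ * N₄) * A₂) ^ 4 :=
        mul_le_mul_of_nonneg_left (pow_le_pow_left₀ (by positivity) h2 4) (by positivity)
    _ = (N₂ * N₃ * N₄) ^ 8 * (N₁ ^ 2 * (N₃ * N₄)) ^ 4 * (A₂ ^ 2) ^ 2 := by ring
    _ ≤ (N₂ * N₃ * N₄) ^ 8 * (N₁ ^ 2 * (N₃ * N₄)) ^ 4 * (N₁ ^ 2 * N₂ ^ 2 * N₄ * A₃) ^ 2 :=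
        mul_le_mul_of_nonneg_left (pow_le_pow_left₀ (by positivity) h3 2) (by positivity)
    _ = (N₂ * N₃ * N₄) ^ 8 * (N₁ ^ 2 * (N₃ * N₄)) ^ 4 * (N₁ ^ 2 * N₂ ^ 2 * N₄) ^ 2 * A₃ ^ 2 := by
        ring
    _ ≤ (N₂ * N₃ * N₄) ^ 8 * (N₁ ^ 2 * (N₃ * N₄)) ^ 4 * (N₁ ^ 2 * N₂ ^ 2 * N₄) ^ 2 *
          (N₁ ^ 2 * N₂ ^ 2 * N₃ ^ 2 * R) :=
        mul_le_mul_of_nonneg_left h4 (by positivity)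
    _ = (N₁ * N₂ * N₃ * N₄) ^ 14 * R := by ring

variable {X₁ X₂ X₃ X₄ : Type*}

/-- **Lemma 38, third form (box Cauchy–Schwarz in four variables).**  For `K : X₁×X₂×X₃×X₄ → ℂ`
and `1`-bounded `b₁(x₂,x₃,x₄)`, `b₂(x₁,x₃,x₄)`, `b₃(x₁,x₂,x₄)`, `b₄(x₁,x₂,x₃)`,
`‖∑ b₁b₂b₃b₄K‖¹⁶ ≤ (#X₁#X₂#X₃#X₄)¹⁴ · Re ∑_{x₁,x₁',…,x₄,x₄'} ∏_{i∈{0,1}⁴} C^{|i|} K(x_{1,i₁},…,x_{4,i₄})`,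
the sixteenfold product being written as the iterated "doubling"
`K₄ = K₃(x₄) conj K₃(x₄')`, `K₃ = K₂(x₃) conj K₂(x₃')`, `K₂ = K₁(x₂) conj K₁(x₂')`,
`K₁ = K(x₁) conj K(x₁')`. [cite: GreenTao2008QuadraticMobius, App. A Lemma 38 (third claim)] -/
theorem box_norm_pow_sixteen_le (s₁ : Finset X₁) (s₂ : Finset X₂) (s₃ : Finset X₃)
    (s₄ : Finset X₄) (b₁ : X₂ → X₃ → X₄ → ℂ) (b₂ : X₁ → X₃ → X₄ → ℂ) (b₃ : X₁ → X₂ → X₄ → ℂ)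
    (b₄ : X₁ → X₂ → X₃ → ℂ) (hb₁ : ∀ x₂ x₃ x₄, ‖b₁ x₂ x₃ x₄‖ ≤ 1)
    (hb₂ : ∀ x₁ x₃ x₄, ‖b₂ x₁ x₃ x₄‖ ≤ 1) (hb₃ : ∀ x₁ x₂ x₄, ‖b₃ x₁ x₂ x₄‖ ≤ 1)
    (hb₄ : ∀ x₁ x₂ x₃, ‖b₄ x₁ x₂ x₃‖ ≤ 1) (K : X₁ → X₂ → X₃ → X₄ → ℂ) :
    ‖∑ x₁ ∈ s₁, ∑ x₂ ∈ s₂, ∑ x₃ ∈ s₃, ∑ x₄ ∈ s₄,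
        b₁ x₂ x₃ x₄ * b₂ x₁ x₃ x₄ * b₃ x₁ x₂ x₄ * b₄ x₁ x₂ x₃ * K x₁ x₂ x₃ x₄‖ ^ 16 ≤
      ((#s₁ : ℝ) * #s₂ * #s₃ * #s₄) ^ 14 *
        (∑ x₁ ∈ s₁, ∑ x₁' ∈ s₁, ∑ x₂ ∈ s₂, ∑ x₂' ∈ s₂, ∑ x₃ ∈ s₃, ∑ x₃' ∈ s₃,
          ∑ x₄ ∈ s₄, ∑ x₄' ∈ s₄,
          ((K x₁ x₂ x₃ x₄ * conj (K x₁' x₂ x₃ x₄) *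
              conj (K x₁ x₂' x₃ x₄ * conj (K x₁' x₂' x₃ x₄))) *
            conj (K x₁ x₂ x₃' x₄ * conj (K x₁' x₂ x₃' x₄) *
              conj (K x₁ x₂' x₃' x₄ * conj (K x₁' x₂' x₃' x₄)))) *
          conj ((K x₁ x₂ x₃ x₄' * conj (K x₁' x₂ x₃ x₄') *
              conj (K x₁ x₂' x₃ x₄' * conj (K x₁' x₂' x₃ x₄'))) *
            conj (K x₁ x₂ x₃' x₄' * conj (K x₁' x₂ x₃' x₄') *
              conj (K x₁ x₂' x₃' x₄' * conj (K x₁' x₂' x₃' x₄'))))).re := by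
  -- the doubled kernels and coefficient functions (as opaque local functions)
  obtain ⟨K₁, hK₁⟩ : ∃ K₁ : X₁ → X₁ → X₂ → X₃ → X₄ → ℂ, K₁ = fun x₁ x₁' x₂ x₃ x₄ =>
    K x₁ x₂ x₃ x₄ * conj (K x₁' x₂ x₃ x₄) := ⟨_, rfl⟩
  obtain ⟨K₂, hK₂⟩ : ∃ K₂ : X₁ → X₁ → X₂ → X₂ → X₃ → X₄ → ℂ, K₂ = fun x₁ x₁' x₂ x₂' x₃ x₄ =>
    K₁ x₁ x₁' x₂ x₃ x₄ * conj (K₁ x₁ x₁' x₂' x₃ x₄) := ⟨_, rfl⟩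
  obtain ⟨K₃, hK₃⟩ : ∃ K₃ : X₁ → X₁ → X₂ → X₂ → X₃ → X₃ → X₄ → ℂ,
    K₃ = fun x₁ x₁' x₂ x₂' x₃ x₃' x₄ =>
      K₂ x₁ x₁' x₂ x₂' x₃ x₄ * conj (K₂ x₁ x₁' x₂ x₂' x₃' x₄) := ⟨_, rfl⟩
  obtain ⟨B₂, hB₂⟩ : ∃ B₂ : X₁ → X₁ → X₃ → X₄ → ℂ, B₂ = fun x₁ x₁' x₃ x₄ =>
    b₂ x₁ x₃ x₄ * conj (b₂ x₁' x₃ x₄) := ⟨_, rfl⟩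
  obtain ⟨B₃, hB₃⟩ : ∃ B₃ : X₁ → X₁ → X₂ → X₄ → ℂ, B₃ = fun x₁ x₁' x₂ x₄ =>
    b₃ x₁ x₂ x₄ * conj (b₃ x₁' x₂ x₄) := ⟨_, rfl⟩
  obtain ⟨B₄, hB₄⟩ : ∃ B₄ : X₁ → X₁ → X₂ → X₃ → ℂ, B₄ = fun x₁ x₁' x₂ x₃ =>
    b₄ x₁ x₂ x₃ * conj (b₄ x₁' x₂ x₃) := ⟨_, rfl⟩
  obtain ⟨C₃, hC₃⟩ : ∃ C₃ : X₁ → X₁ → X₂ → X₂ → X₄ → ℂ, C₃ = fun x₁ x₁' x₂ x₂' x₄ =>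
    B₃ x₁ x₁' x₂ x₄ * conj (B₃ x₁ x₁' x₂' x₄) := ⟨_, rfl⟩
  obtain ⟨C₄, hC₄⟩ : ∃ C₄ : X₁ → X₁ → X₂ → X₂ → X₃ → ℂ, C₄ = fun x₁ x₁' x₂ x₂' x₃ =>
    B₄ x₁ x₁' x₂ x₃ * conj (B₄ x₁ x₁' x₂' x₃) := ⟨_, rfl⟩
  obtain ⟨D₄, hD₄⟩ : ∃ D₄ : X₁ → X₁ → X₂ → X₂ → X₃ → X₃ → ℂ, D₄ = fun x₁ x₁' x₂ x₂' x₃ x₃' =>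
    C₄ x₁ x₁' x₂ x₂' x₃ * conj (C₄ x₁ x₁' x₂ x₂' x₃') := ⟨_, rfl⟩
  -- norm bounds: products of two `1`-bounded numbers (one conjugated) are `1`-bounded
  have hmc : ∀ u v : ℂ, ‖u‖ ≤ 1 → ‖v‖ ≤ 1 → ‖u * conj v‖ ≤ 1 := fun u v hu hv => by
    rw [norm_mul, Complex.norm_conj]
    calc ‖u‖ * ‖v‖ ≤ 1 * 1 := mul_le_mul hu hv (norm_nonneg _) zero_le_one
      _ = 1 := one_mul _
  have hB₂b : ∀ x₁ x₁' x₃ x₄, ‖B₂ x₁ x₁' x₃ x₄‖ ≤ 1 := fun _ _ _ _ => by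
    rw [hB₂]; exact hmc _ _ (hb₂ _ _ _) (hb₂ _ _ _)
  have hB₃b : ∀ x₁ x₁' x₂ x₄, ‖B₃ x₁ x₁' x₂ x₄‖ ≤ 1 := fun _ _ _ _ => by
    rw [hB₃]; exact hmc _ _ (hb₃ _ _ _) (hb₃ _ _ _)
  have hB₄b : ∀ x₁ x₁' x₂ x₃, ‖B₄ x₁ x₁' x₂ x₃‖ ≤ 1 := fun _ _ _ _ => by
    rw [hB₄]; exact hmc _ _ (hb₄ _ _ _) (hb₄ _ _ _)
  have hC₃b : ∀ x₁ x₁' x₂ x₂' x₄, ‖C₃ x₁ x₁' x₂ x₂' x₄‖ ≤ 1 := fun _ _ _ _ _ => by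
    rw [hC₃]; exact hmc _ _ (hB₃b _ _ _ _) (hB₃b _ _ _ _)
  have hC₄b : ∀ x₁ x₁' x₂ x₂' x₃, ‖C₄ x₁ x₁' x₂ x₂' x₃‖ ≤ 1 := fun _ _ _ _ _ => by
    rw [hC₄]; exact hmc _ _ (hB₄b _ _ _ _) (hB₄b _ _ _ _)
  have hD₄b : ∀ x₁ x₁' x₂ x₂' x₃ x₃', ‖D₄ x₁ x₁' x₂ x₂' x₃ x₃'‖ ≤ 1 := fun _ _ _ _ _ _ => by
    rw [hD₄]; exact hmc _ _ (hC₄b _ _ _ _ _) (hC₄b _ _ _ _ _)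
  ------------------------------------------------------------------
  -- Step 1: double `x₁` (no parameters; `Y = X₂ × (X₃ × X₄)`)
  ------------------------------------------------------------------
  obtain ⟨f₁, hf₁⟩ : ∃ f₁ : X₁ → X₂ × (X₃ × X₄) → ℂ, f₁ = fun x₁ y =>
    b₂ x₁ y.2.1 y.2.2 * b₃ x₁ y.1 y.2.2 * b₄ x₁ y.1 y.2.1 * K x₁ y.1 y.2.1 y.2.2 := ⟨_, rfl⟩
  obtain ⟨A₁, hA₁⟩ : ∃ A₁ : ℝ, A₁ = ∑ p ∈ s₁ ×ˢ s₁, ‖∑ z ∈ s₃ ×ˢ s₄, ∑ x₂ ∈ s₂,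
    B₂ p.1 p.2 z.1 z.2 * (B₃ p.1 p.2 x₂ z.2 * B₄ p.1 p.2 x₂ z.1 * K₁ p.1 p.2 x₂ z.1 z.2)‖ :=
    ⟨_, rfl⟩
  have hS : ∑ x₁ ∈ s₁, ∑ x₂ ∈ s₂, ∑ x₃ ∈ s₃, ∑ x₄ ∈ s₄,
        b₁ x₂ x₃ x₄ * b₂ x₁ x₃ x₄ * b₃ x₁ x₂ x₄ * b₄ x₁ x₂ x₃ * K x₁ x₂ x₃ x₄ =
      ∑ y ∈ s₂ ×ˢ (s₃ ×ˢ s₄), ∑ x₁ ∈ s₁, b₁ y.1 y.2.1 y.2.2 * f₁ x₁ y := by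
    rw [Finset.sum_product]
    calc ∑ x₁ ∈ s₁, ∑ x₂ ∈ s₂, ∑ x₃ ∈ s₃, ∑ x₄ ∈ s₄,
          b₁ x₂ x₃ x₄ * b₂ x₁ x₃ x₄ * b₃ x₁ x₂ x₄ * b₄ x₁ x₂ x₃ * K x₁ x₂ x₃ x₄
        = ∑ x₂ ∈ s₂, ∑ x₁ ∈ s₁, ∑ x₃ ∈ s₃, ∑ x₄ ∈ s₄,
            b₁ x₂ x₃ x₄ * b₂ x₁ x₃ x₄ * b₃ x₁ x₂ x₄ * b₄ x₁ x₂ x₃ * K x₁ x₂ x₃ x₄ :=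
          Finset.sum_comm
      _ = ∑ x₂ ∈ s₂, ∑ z ∈ s₃ ×ˢ s₄, ∑ x₁ ∈ s₁,
            b₁ x₂ z.1 z.2 * b₂ x₁ z.1 z.2 * b₃ x₁ x₂ z.2 * b₄ x₁ x₂ z.1 * K x₁ x₂ z.1 z.2 := by
          refine Finset.sum_congr rfl fun x₂ _ => ?_
          rw [Finset.sum_product]
          calc ∑ x₁ ∈ s₁, ∑ x₃ ∈ s₃, ∑ x₄ ∈ s₄,
                b₁ x₂ x₃ x₄ * b₂ x₁ x₃ x₄ * b₃ x₁ x₂ x₄ * b₄ x₁ x₂ x₃ * K x₁ x₂ x₃ x₄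
              = ∑ x₃ ∈ s₃, ∑ x₁ ∈ s₁, ∑ x₄ ∈ s₄,
                  b₁ x₂ x₃ x₄ * b₂ x₁ x₃ x₄ * b₃ x₁ x₂ x₄ * b₄ x₁ x₂ x₃ * K x₁ x₂ x₃ x₄ :=
                Finset.sum_comm
            _ = _ := Finset.sum_congr rfl fun x₃ _ => Finset.sum_comm
      _ = _ := by
          refine Finset.sum_congr rfl fun x₂ _ => Finset.sum_congr rfl fun z _ =>
            Finset.sum_congr rfl fun x₁ _ => ?_
          rw [hf₁]; ring
  have h1 : ‖∑ x₁ ∈ s₁, ∑ x₂ ∈ s₂, ∑ x₃ ∈ s₃, ∑ x₄ ∈ s₄,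
        b₁ x₂ x₃ x₄ * b₂ x₁ x₃ x₄ * b₃ x₁ x₂ x₄ * b₄ x₁ x₂ x₃ * K x₁ x₂ x₃ x₄‖ ^ 2 ≤
      (#s₂ : ℝ) * #s₃ * #s₄ * A₁ := by
    rw [hS]
    refine (gen_step₀ (s₂ ×ˢ (s₃ ×ˢ s₄)) s₁ (fun y => b₁ y.1 y.2.1 y.2.2)
      (fun y => hb₁ y.1 y.2.1 y.2.2) f₁).trans (le_of_eq ?_)
    rw [Finset.card_product, Finset.card_product, hA₁, Finset.sum_product (s := s₁) (t := s₁)]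
    push_cast
    congr 1
    · ring
    refine Finset.sum_congr rfl fun x₁ _ => Finset.sum_congr rfl fun x₁' _ => ?_
    congr 1
    rw [Finset.sum_product, Finset.sum_comm]
    refine Finset.sum_congr rfl fun z _ => Finset.sum_congr rfl fun x₂ _ => ?_
    rw [hf₁, hB₂, hB₃, hB₄, hK₁]
    simp only [map_mul]
    ring
  ------------------------------------------------------------------
  -- Step 2: double `x₂` (parameters `(x₁,x₁')`; `Y = X₃ × X₄`)
  ------------------------------------------------------------------
  obtain ⟨A₂, hA₂⟩ : ∃ A₂ : ℝ, A₂ = ∑ q ∈ (s₁ ×ˢ s₁) ×ˢ (s₂ ×ˢ s₂), ‖∑ x₄ ∈ s₄, ∑ x₃ ∈ s₃,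
    C₃ q.1.1 q.1.2 q.2.1 q.2.2 x₄ *
      (C₄ q.1.1 q.1.2 q.2.1 q.2.2 x₃ * K₂ q.1.1 q.1.2 q.2.1 q.2.2 x₃ x₄)‖ := ⟨_, rfl⟩
  have h2 : A₁ ^ 2 ≤ (#s₁ : ℝ) ^ 2 * (#s₃ * #s₄) * A₂ := by
    have h := gen_step (s₁ ×ˢ s₁) (s₃ ×ˢ s₄) s₂ (fun p z => B₂ p.1 p.2 z.1 z.2)
      (fun p z => hB₂b _ _ _ _)
      (fun p x₂ z => B₃ p.1 p.2 x₂ z.2 * B₄ p.1 p.2 x₂ z.1 * K₁ p.1 p.2 x₂ z.1 z.2)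
    rw [hA₁]
    refine h.trans (le_of_eq ?_)
    rw [Finset.card_product, Finset.card_product, hA₂, Finset.sum_product (t := s₂ ×ˢ s₂)]
    push_cast
    congr 1
    · ring
    refine Finset.sum_congr rfl fun p _ => ?_
    rw [Finset.sum_product (s := s₂) (t := s₂)]
    refine Finset.sum_congr rfl fun x₂ _ => Finset.sum_congr rfl fun x₂' _ => ?_
    congr 1
    rw [Finset.sum_product, Finset.sum_comm]
    refine Finset.sum_congr rfl fun x₄ _ => Finset.sum_congr rfl fun x₃ _ => ?_
    rw [hC₃, hC₄, hK₂]
    simp only [map_mul]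
    ring
  ------------------------------------------------------------------
  -- Step 3: double `x₃` (parameters `((x₁,x₁'),(x₂,x₂'))`; `Y = X₄`)
  ------------------------------------------------------------------
  obtain ⟨A₃, hA₃⟩ : ∃ A₃ : ℝ, A₃ = ∑ r ∈ ((s₁ ×ˢ s₁) ×ˢ (s₂ ×ˢ s₂)) ×ˢ (s₃ ×ˢ s₃),
    ‖∑ x₄ ∈ s₄, D₄ r.1.1.1 r.1.1.2 r.1.2.1 r.1.2.2 r.2.1 r.2.2 *
      K₃ r.1.1.1 r.1.1.2 r.1.2.1 r.1.2.2 r.2.1 r.2.2 x₄‖ := ⟨_, rfl⟩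
  have h3 : A₂ ^ 2 ≤ (#s₁ : ℝ) ^ 2 * (#s₂ : ℝ) ^ 2 * #s₄ * A₃ := by
    have h := gen_step ((s₁ ×ˢ s₁) ×ˢ (s₂ ×ˢ s₂)) s₄ s₃
      (fun q x₄ => C₃ q.1.1 q.1.2 q.2.1 q.2.2 x₄) (fun q x₄ => hC₃b _ _ _ _ _)
      (fun q x₃ x₄ => C₄ q.1.1 q.1.2 q.2.1 q.2.2 x₃ * K₂ q.1.1 q.1.2 q.2.1 q.2.2 x₃ x₄)
    rw [hA₂]
    refine h.trans (le_of_eq ?_)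
    rw [Finset.card_product, Finset.card_product, Finset.card_product, hA₃,
      Finset.sum_product (t := s₃ ×ˢ s₃)]
    push_cast
    congr 1
    · ring
    refine Finset.sum_congr rfl fun q _ => ?_
    rw [Finset.sum_product (s := s₃) (t := s₃)]
    refine Finset.sum_congr rfl fun x₃ _ => Finset.sum_congr rfl fun x₃' _ => ?_
    congr 1
    refine Finset.sum_congr rfl fun x₄ _ => ?_
    rw [hD₄, hK₃]
    simp only [map_mul]
    ring
  ------------------------------------------------------------------
  -- Step 4: double `x₄` (parameters of all six kinds; real part kept)
  ------------------------------------------------------------------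
  obtain ⟨R, hR⟩ : ∃ R : ℝ, R = (∑ r ∈ ((s₁ ×ˢ s₁) ×ˢ (s₂ ×ˢ s₂)) ×ˢ (s₃ ×ˢ s₃),
    ∑ x₄ ∈ s₄, ∑ x₄' ∈ s₄,
      K₃ r.1.1.1 r.1.1.2 r.1.2.1 r.1.2.2 r.2.1 r.2.2 x₄ *
        conj (K₃ r.1.1.1 r.1.1.2 r.1.2.1 r.1.2.2 r.2.1 r.2.2 x₄')).re := ⟨_, rfl⟩
  have h4 : A₃ ^ 2 ≤ (#s₁ : ℝ) ^ 2 * (#s₂ : ℝ) ^ 2 * (#s₃ : ℝ) ^ 2 * R := by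
    have h := final_step (((s₁ ×ˢ s₁) ×ˢ (s₂ ×ˢ s₂)) ×ˢ (s₃ ×ˢ s₃)) s₄
      (fun r => D₄ r.1.1.1 r.1.1.2 r.1.2.1 r.1.2.2 r.2.1 r.2.2) (fun r => hD₄b _ _ _ _ _ _)
      (fun r x₄ => K₃ r.1.1.1 r.1.1.2 r.1.2.1 r.1.2.2 r.2.1 r.2.2 x₄)
    rw [hA₃]
    refine h.trans (le_of_eq ?_)
    rw [Finset.card_product, Finset.card_product, Finset.card_product, Finset.card_product,
      Finset.card_product, hR]
    push_cast
    ring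
  -- the real part `R`, unfolded
  have hR' : R = (∑ x₁ ∈ s₁, ∑ x₁' ∈ s₁, ∑ x₂ ∈ s₂, ∑ x₂' ∈ s₂, ∑ x₃ ∈ s₃, ∑ x₃' ∈ s₃,
      ∑ x₄ ∈ s₄, ∑ x₄' ∈ s₄,
      ((K x₁ x₂ x₃ x₄ * conj (K x₁' x₂ x₃ x₄) *
          conj (K x₁ x₂' x₃ x₄ * conj (K x₁' x₂' x₃ x₄))) *
        conj (K x₁ x₂ x₃' x₄ * conj (K x₁' x₂ x₃' x₄) *
          conj (K x₁ x₂' x₃' x₄ * conj (K x₁' x₂' x₃' x₄)))) *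
      conj ((K x₁ x₂ x₃ x₄' * conj (K x₁' x₂ x₃ x₄') *
          conj (K x₁ x₂' x₃ x₄' * conj (K x₁' x₂' x₃ x₄'))) *
        conj (K x₁ x₂ x₃' x₄' * conj (K x₁' x₂ x₃' x₄') *
          conj (K x₁ x₂' x₃' x₄' * conj (K x₁' x₂' x₃' x₄'))))).re := by
    rw [hR]
    congr 1
    rw [Finset.sum_product, Finset.sum_product, Finset.sum_product]
    refine Finset.sum_congr rfl fun x₁ _ => Finset.sum_congr rfl fun x₁' _ => ?_
    rw [Finset.sum_product]
    refine Finset.sum_congr rfl fun x₂ _ => Finset.sum_congr rfl fun x₂' _ => ?_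
    rw [Finset.sum_product]
    refine Finset.sum_congr rfl fun x₃ _ => Finset.sum_congr rfl fun x₃' _ =>
      Finset.sum_congr rfl fun x₄ _ => Finset.sum_congr rfl fun x₄' _ => ?_
    rw [hK₃, hK₂, hK₁]
  -- chain the four steps
  calc ‖∑ x₁ ∈ s₁, ∑ x₂ ∈ s₂, ∑ x₃ ∈ s₃, ∑ x₄ ∈ s₄,
        b₁ x₂ x₃ x₄ * b₂ x₁ x₃ x₄ * b₃ x₁ x₂ x₄ * b₄ x₁ x₂ x₃ * K x₁ x₂ x₃ x₄‖ ^ 16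
      ≤ ((#s₁ : ℝ) * #s₂ * #s₃ * #s₄) ^ 14 * R :=
        chain_ineq h1 h2 h3 h4
    _ = _ := by rw [hR']

end Summit.Parity.GeneralizedHardyLittlewood.GreenTaoLevelTwoMNTwoBoxCauchySchwarz
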